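import Literature.NumberTheory.Sieve.FordMaynardPrimeSumsTuples
import Literature.NumberTheory.Sieve.FordMaynardSliceConvolution
import Mathlib.MeasureTheory.Measure.Haar.NormedSpace
import Mathlib.MeasureTheory.Group.Measure
import HarnessLib

/-!
# From prime tuple integrals to the Type-I identity (slicing and scaling)

Third file of the arithmetic half of Theorem 6.3 (a) / Theorem 9.1 of K. Ford, J. Maynard,
*On the theory of prime producing sieves* (arXiv:2407.14368). Everything here is PROVED. The
comparison integrals `∫_{ℝ^s} G(y) ∏ x^{yᵢ} dyᵢ/yᵢ` of `FordMaynardPrimeSumsTuples.lean`, for the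
test functions `G(y) = h((u, y)/(λ + |y|)) 𝟙(c₀ < |y| ≤ c₁)` that arise from a sequence
`w_n = h(𝐯(n))` at a fixed divisor `m = x^λ` with prime logarithms `u`, are rewritten as
`∫ x^w/(λ+w) · (s! · typeITerm h t (u/(λ+w)) s) dw` — Ford–Maynard's display after (Smcd) in
§6.2 — so that their sum over `s` with weights `1/s!` VANISHES by (TypeI-f)
(`sum_primeTupleIntegral_mainG_eq_zero`). Ingredients:

* `integral_eq_integral_sliceIntegral` — `∫_{ℝ^{d+1}} F = ∫_w ∫_{|y| = w} F dw` for `F`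
  integrable and supported in the open positive orthant (Fubini and the shear `y_{d+1} ↔ |y|`);
* `sliceIntegral_comp_smul` — scaling `y ↦ y/ρ` in slice integrals;
* `mainG`, `normVec` — the test functions and the normalisation `(u, y)/(λ + |y|)`.

## References

* K. Ford, J. Maynard, *On the theory of prime producing sieves*, arXiv:2407.14368v1 (2024), §6.2,
  proof of Theorem 6.3 (a) (the three displays following (Smcd)). [FordMaynard2024PrimeSieves]
-/

noncomputable section

open MeasureTheory Finset Real

namespace Literature.NumberTheory.Sieve.FordMaynard

/-! ### Slicing `ℝ^{d+1}` by the hyperplanes `|y| = w` -/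

/-- The shear `(u, w) ↦ (u, w − |u|)` of `ℝ^d × ℝ` preserves Lebesgue measure. [folklore] -/
theorem measurePreserving_shear (d : ℕ) :
    MeasurePreserving (fun q : (Fin d → ℝ) × ℝ => (q.1, q.2 - ∑ i, q.1 i))
      ((volume : Measure (Fin d → ℝ)).prod volume) ((volume : Measure (Fin d → ℝ)).prod volume) := by
  have h := MeasurePreserving.skew_product (μa := (volume : Measure (Fin d → ℝ)))
    (μc := (volume : Measure ℝ)) (μd := (volume : Measure ℝ)) (f := id)
    (g := fun (u : Fin d → ℝ) (w : ℝ) => w - ∑ i, u i) (MeasurePreserving.id _) ?_ ?_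
  · simpa using h
  · exact measurable_snd.sub ((Finset.measurable_sum _ fun i _ => measurable_pi_apply i).comp
      measurable_fst)
  · exact Filter.Eventually.of_forall fun u => (measurePreserving_sub_right volume _).map_eq

/-- **Slicing formula.** For `F` integrable on `ℝ^{d+1}` and supported in the open positive
orthant, `∫ F = ∫_w sliceIntegral (d+1) w F dw`, and the slice integrals are an integrable
function of `w`. [cite: FordMaynard2024PrimeSieves, §4.2 (Notational convention)] -/
theorem integral_eq_integral_sliceIntegral {d : ℕ} {F : (Fin (d + 1) → ℝ) → ℝ}
    (hF : Integrable F) (hsupp : ∀ y, F y ≠ 0 → ∀ i, 0 < y i) :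
    (∫ y, F y) = ∫ w, sliceIntegral (d + 1) w F ∧
      Integrable (fun w => sliceIntegral (d + 1) w F) := by
  -- Step 1: `∫ F = ∫_{(t, u)} F(snoc u t)`
  set e := MeasurableEquiv.piFinSuccAbove (fun _ : Fin (d + 1) => ℝ) (Fin.last d) with he
  have hmp : MeasurePreserving e := volume_preserving_piFinSuccAbove (fun _ : Fin (d + 1) => ℝ) _
  set Fs : ℝ × (Fin d → ℝ) → ℝ := fun p => F (Fin.snoc p.2 p.1) with hFs
  have h1 : ∫ y, F y = ∫ p, Fs p ∂((volume : Measure ℝ).prod volume) := by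
    rw [show ((volume : Measure ℝ).prod (volume : Measure (Fin d → ℝ))) = volume from rfl,
      ← hmp.symm.integral_comp' (f := e.symm)]
    refine integral_congr_ae (Filter.Eventually.of_forall fun p => ?_)
    show F (e.symm p) = F (Fin.snoc p.2 p.1)
    rw [he, piFinSuccAbove_last_symm_apply]
  have hFs_int : Integrable Fs ((volume : Measure ℝ).prod volume) := by
    have := hmp.symm.integrable_comp_emb e.symm.measurableEmbedding |>.2 hF
    refine (integrable_congr (Filter.Eventually.of_forall fun p => ?_)).1 this
    show F (e.symm p) = _
    rw [he, piFinSuccAbove_last_symm_apply]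
  -- Step 2: swap to `(u, t)`
  set Fq : (Fin d → ℝ) × ℝ → ℝ := fun q => F (Fin.snoc q.1 q.2) with hFq
  have hFq_eq : Fq = Fs ∘ Prod.swap := rfl
  have hFq_int : Integrable Fq ((volume : Measure (Fin d → ℝ)).prod volume) := by
    rw [hFq_eq]; exact hFs_int.swap
  have h2 : ∫ p, Fs p ∂((volume : Measure ℝ).prod volume) =
      ∫ q, Fq q ∂((volume : Measure (Fin d → ℝ)).prod volume) := by
    rw [hFq_eq, ← integral_prod_swap]
    rfl
  -- Step 3: the shear `t = w − |u|`
  set Sh : (Fin d → ℝ) × ℝ → (Fin d → ℝ) × ℝ := fun q => (q.1, q.2 - ∑ i, q.1 i) with hSh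
  have hShmp := measurePreserving_shear d
  have hShm : Measurable Sh := hShmp.measurable
  have hae : AEStronglyMeasurable Fq (Measure.map Sh ((volume : Measure (Fin d → ℝ)).prod volume)) := by
    rw [hShmp.map_eq]; exact hFq_int.aestronglyMeasurable
  have h3 : ∫ q, Fq q ∂((volume : Measure (Fin d → ℝ)).prod volume) =
      ∫ q, Fq (Sh q) ∂((volume : Measure (Fin d → ℝ)).prod volume) := by
    conv_lhs => rw [← hShmp.map_eq]
    exact integral_map hShm.aemeasurable hae
  have hFqSh_int : Integrable (Fq ∘ Sh) ((volume : Measure (Fin d → ℝ)).prod volume) := by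
    refine (integrable_map_measure hae hShm.aemeasurable).1 ?_
    rw [hShmp.map_eq]; exact hFq_int
  -- Step 4: Fubini with `w` outside
  have h4 : ∫ q, Fq (Sh q) ∂((volume : Measure (Fin d → ℝ)).prod volume) =
      ∫ w, ∫ u, Fq (Sh (u, w)) := integral_prod_symm _ hFqSh_int
  -- Step 5: the inner integrals are the slice integrals
  have h5 : ∀ w, ∫ u, Fq (Sh (u, w)) = sliceIntegral (d + 1) w F := by
    intro w
    rw [sliceIntegral_succ_eq]
    refine integral_congr_ae (Filter.Eventually.of_forall fun u => ?_)
    show F (Fin.snoc u (w - ∑ i, u i)) = sliceIntegrand d w F u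
    unfold sliceIntegrand
    split_ifs with hc
    · rfl
    · by_contra hne
      have hpos : ∀ i, 0 < (Fin.snoc u (w - ∑ i, u i) : Fin (d + 1) → ℝ) i := hsupp _ hne
      refine hc ⟨fun i => ?_, ?_⟩
      · simpa only [Fin.snoc_castSucc] using hpos (Fin.castSucc i)
      · have := hpos (Fin.last d)
        simp only [Fin.snoc_last] at this
        linarith
  refine ⟨?_, ?_⟩
  · rw [h1, h2, h3, h4]
    exact integral_congr_ae (Filter.Eventually.of_forall h5)
  · have := hFqSh_int.integral_prod_right
    refine (integrable_congr (Filter.Eventually.of_forall fun w => ?_)).1 this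
    exact h5 w

/-! ### Scaling in slice integrals -/

/-- Scaling the slice integrand: for `ρ > 0`,
`sliceIntegrand d w (Ψ(·/ρ)) u = sliceIntegrand d (w/ρ) Ψ (u/ρ)`. [folklore] -/
theorem sliceIntegrand_comp_smul (d : ℕ) (w : ℝ) {ρ : ℝ} (hρ : 0 < ρ) (Ψ : (Fin (d + 1) → ℝ) → ℝ)
    (u : Fin d → ℝ) :
    sliceIntegrand d w (fun y => Ψ (ρ⁻¹ • y)) u = sliceIntegrand d (w / ρ) Ψ (ρ⁻¹ • u) := by
  unfold sliceIntegrand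
  have hρ' : 0 < ρ⁻¹ := inv_pos.2 hρ
  have hcond : ((∀ i, 0 < u i) ∧ ∑ i, u i < w) ↔
      ((∀ i, 0 < (ρ⁻¹ • u) i) ∧ ∑ i, (ρ⁻¹ • u) i < w / ρ) := by
    simp only [Pi.smul_apply, smul_eq_mul]
    rw [← Finset.mul_sum, div_eq_inv_mul]
    constructor
    · rintro ⟨h1, h2⟩
      exact ⟨fun i => mul_pos hρ' (h1 i), mul_lt_mul_of_pos_left h2 hρ'⟩
    · rintro ⟨h1, h2⟩
      exact ⟨fun i => pos_of_mul_pos_right (h1 i) hρ'.le, lt_of_mul_lt_mul_left h2 hρ'.le⟩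
  by_cases hc : (∀ i, 0 < u i) ∧ ∑ i, u i < w
  · rw [if_pos hc, if_pos (hcond.1 hc)]
    show Ψ (ρ⁻¹ • Fin.snoc u (w - ∑ i, u i)) = Ψ _
    congr 1
    funext i
    refine Fin.lastCases ?_ (fun j => ?_) i
    · simp only [Pi.smul_apply, Fin.snoc_last, smul_eq_mul]
      rw [← Finset.mul_sum, div_eq_inv_mul, mul_sub]
    · simp only [Pi.smul_apply, Fin.snoc_castSucc, smul_eq_mul]
  · rw [if_neg hc, if_neg (fun h => hc (hcond.2 h))]

/-- **Scaling in slice integrals**: for `ρ > 0`,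
`sliceIntegral (d+1) w (y ↦ Ψ(y/ρ)) = ρ^d · sliceIntegral (d+1) (w/ρ) Ψ`
(the substitution `y = ρ y'` on the `d`-dimensional slice). [folklore] -/
theorem sliceIntegral_comp_smul (d : ℕ) (w : ℝ) {ρ : ℝ} (hρ : 0 < ρ) (Ψ : (Fin (d + 1) → ℝ) → ℝ) :
    sliceIntegral (d + 1) w (fun y => Ψ (ρ⁻¹ • y)) = ρ ^ d * sliceIntegral (d + 1) (w / ρ) Ψ := by
  rw [sliceIntegral_succ_eq, sliceIntegral_succ_eq]
  have h1 : (fun u => sliceIntegrand d w (fun y => Ψ (ρ⁻¹ • y)) u) =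
      fun u => sliceIntegrand d (w / ρ) Ψ (ρ⁻¹ • u) := by
    funext u; exact sliceIntegrand_comp_smul d w hρ Ψ u
  rw [h1, Measure.integral_comp_smul (μ := (volume : Measure (Fin d → ℝ)))
    (fun u => sliceIntegrand d (w / ρ) Ψ u) ρ⁻¹]
  rw [Module.finrank_fintype_fun_eq_card, Fintype.card_fin, smul_eq_mul]
  congr 1
  rw [inv_pow, inv_inv, abs_of_pos (pow_pos hρ d)]

/-! ### The test functions of a fixed divisor `m = x^λ` -/

/-- The normalised concatenation `(u, y)/(λ + |y|)`, `λ = |u|`: the vector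
`𝐯(mr) = (log p₁, …, log p_t, log q₁, …, log q_s)/log(mr)` of `n = mr` in the coordinates
`u = (log pᵢ/log x)`, `y = (log qⱼ/log x)`. [cite: FordMaynard2024PrimeSieves, §6.2 (Smcd)] -/
def normVec {t s : ℕ} (u : Fin t → ℝ) (y : Fin s → ℝ) : Fin (t + s) → ℝ :=
  fun i => Fin.append u y i / ((∑ j, u j) + ∑ j, y j)

/-- The test function of dimension `s` attached to `h`, the fixed part `u ∈ ℝ^t` and the range
`(c₀, c₁]` of `|y|`: `G(y) = h(t+s)((u,y)/(λ+|y|)) · 𝟙(c₀ < |y| ≤ c₁)`.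
[cite: FordMaynard2024PrimeSieves, §6.2 (Smcd)] -/
def mainG (h : VecFn) (t s : ℕ) (u : Fin t → ℝ) (c₀ c₁ : ℝ) (y : Fin s → ℝ) : ℝ :=
  if c₀ < ∑ j, y j ∧ ∑ j, y j ≤ c₁ then h (t + s) (normVec u y) else 0

/-- Dividing a concatenation by a scalar. [folklore] -/
theorem append_div {t s : ℕ} (u : Fin t → ℝ) (y : Fin s → ℝ) (ρ : ℝ) :
    (fun i => Fin.append u y i / ρ) = Fin.append (fun i => u i / ρ) (fun i => y i / ρ) := by
  funext i
  refine Fin.addCases (fun j => ?_) (fun j => ?_) i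
  · simp only [Fin.append_left]
  · simp only [Fin.append_right]

/-- On the slice `|y| = w`: `normVec u y = append (u/ρ) (ρ⁻¹ • y)` with `ρ = λ + w`. [folklore] -/
theorem normVec_eq_append {t s : ℕ} (u : Fin t → ℝ) (y : Fin s → ℝ) {w : ℝ}
    (hw : ∑ j, y j = w) :
    normVec u y = Fin.append (fun i => u i / ((∑ j, u j) + w)) ((((∑ j, u j) + w))⁻¹ • y) := by
  unfold normVec
  rw [hw, append_div]
  congr 1
  funext i
  simp [div_eq_inv_mul]

/-! ### The main term vanishes -/

/-- A crude integrability statement for `mainG · tupleWeight`. [folklore] -/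
theorem integrable_mainG_mul_tupleWeight {h : VecFn} {η Hb : ℝ} (hη : 0 < η)
    (hsupp : ∀ (k : ℕ) (v : Fin k → ℝ), h k v ≠ 0 → ∀ i, η ≤ v i)
    (hbdd : ∀ (k : ℕ) (v : Fin k → ℝ), |h k v| ≤ Hb) (hmeas : ∀ k, Measurable (h k))
    {x : ℝ} (hx : 1 < x) {t : ℕ} (u : Fin t → ℝ) {c₀ c₁ : ℝ} (hc₁ : c₁ ≤ 1)
    (hlc₀ : 0 < (∑ i, u i) + c₀) (s : ℕ) :
    Integrable (fun y : Fin s → ℝ => mainG h t s u c₀ c₁ y * tupleWeight x y) ∧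
      ∀ y : Fin s → ℝ, mainG h t s u c₀ c₁ y * tupleWeight x y ≠ 0 → ∀ i, 0 < y i := by
  have hx0 : 0 < x := by linarith
  have hHb : 0 ≤ Hb := (abs_nonneg _).trans (hbdd 0 fun i => i.elim0)
  set η'' : ℝ := η * ((∑ i, u i) + c₀) with hη''
  have hη''0 : 0 < η'' := mul_pos hη hlc₀
  -- support of `mainG`
  have hbox : ∀ y : Fin s → ℝ, mainG h t s u c₀ c₁ y ≠ 0 → ∀ i, η'' ≤ y i ∧ y i ≤ 1 := by
    intro y hy
    unfold mainG at hy
    split_ifs at hy with hc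
    · have hρ : 0 < (∑ j, u j) + ∑ j, y j := by linarith [hc.1]
      have hall := hsupp _ _ hy
      have hyi : ∀ i, η'' ≤ y i := by
        intro i
        have := hall (Fin.natAdd t i)
        simp only [normVec, Fin.append_right] at this
        rw [le_div_iff₀ hρ] at this
        calc η'' ≤ η * ((∑ j, u j) + ∑ j, y j) := by
              rw [hη'']; exact mul_le_mul_of_nonneg_left (by linarith [hc.1]) hη.le
          _ ≤ y i := this
      intro i
      refine ⟨hyi i, ?_⟩
      have hrest : y i ≤ ∑ j, y j :=
        Finset.single_le_sum (fun j _ => hη''0.le.trans (hyi j)) (Finset.mem_univ i)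
      linarith [hc.2]
    · exact absurd rfl hy
  have hmeasG : Measurable (mainG h t s u c₀ c₁) := by
    unfold mainG
    refine Measurable.ite ?_ ((hmeas _).comp ?_) measurable_const
    · exact (measurableSet_lt measurable_const (Finset.measurable_sum _ fun i _ => measurable_pi_apply i)).inter
        (measurableSet_le (Finset.measurable_sum _ fun i _ => measurable_pi_apply i) measurable_const)
    · unfold normVec
      refine measurable_pi_lambda _ fun i => ?_
      refine Measurable.div ?_ (measurable_const.add (Finset.measurable_sum _ fun i _ => measurable_pi_apply i))
      refine Fin.addCases (fun j => ?_) (fun j => ?_) i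
      · simp only [Fin.append_left]; exact measurable_const
      · simp only [Fin.append_right]; exact measurable_pi_apply j
  refine ⟨?_, ?_⟩
  · refine integrable_of_bdd_of_support_box (hmeasG.mul (measurable_tupleWeight hx0))
      (B := Hb * (x / η'') ^ s) (a := η'') (b := 1) (fun y => ?_) (fun y hy => ?_)
    · by_cases hG : mainG h t s u c₀ c₁ y = 0
      · rw [hG, zero_mul, abs_zero]; positivity
      · have hw := tupleWeight_bounds hx.le hη''0 (hbox y hG)
        rw [abs_mul, abs_of_nonneg hw.1]
        refine mul_le_mul ?_ hw.2 hw.1 hHb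
        unfold mainG; split_ifs
        · exact hbdd _ _
        · rw [abs_zero]; exact hHb
    · have hG : mainG h t s u c₀ c₁ y ≠ 0 := fun h0 => hy (by rw [h0, zero_mul])
      exact ⟨fun i => (hbox y hG i).1, fun i => (hbox y hG i).2⟩
  · intro y hy i
    have hG : mainG h t s u c₀ c₁ y ≠ 0 := fun h0 => hy (by rw [h0, zero_mul])
    exact lt_of_lt_of_le hη''0 (hbox y hG i).1

/-- **The slice integrals of the main term.** For `c₀ < w ≤ c₁` and `ρ = λ + w > 0`,
`sliceIntegral (d+1) w (mainG · tupleWeight) = x^w/ρ · (d+1)! · typeITerm h t (u/ρ) (d+1)`;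
for `w` outside `(c₀, c₁]` it vanishes. [cite: FordMaynard2024PrimeSieves, §6.2 (proof of Theorem 6.3 (a))] -/
theorem sliceIntegral_mainG (h : VecFn) {x : ℝ} (hx : 0 < x) {t : ℕ} (u : Fin t → ℝ)
    (c₀ c₁ : ℝ) (d : ℕ) (w : ℝ) (hρ : 0 < (∑ i, u i) + w) :
    sliceIntegral (d + 1) w (fun y => mainG h t (d + 1) u c₀ c₁ y * tupleWeight x y) =
      if c₀ < w ∧ w ≤ c₁ then
        x ^ w / ((∑ i, u i) + w) * (((d + 1).factorial : ℝ) *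
          typeITerm h t (fun i => u i / ((∑ i, u i) + w)) (d + 1))
      else 0 := by
  set ρ : ℝ := (∑ i, u i) + w with hρdef
  set ξ : Fin t → ℝ := fun i => u i / ρ with hξ
  split_ifs with hc
  · -- on the slice: `mainG · weight = x^w · Ψ(y/ρ)` with `Ψ(z) = h(append ξ z)/(ρ^{d+1} ∏ z)`
    set Ψ : (Fin (d + 1) → ℝ) → ℝ := fun z => h (t + (d + 1)) (Fin.append ξ z) / (ρ ^ (d + 1) * ∏ i, z i)
      with hΨ
    have hcongr : sliceIntegral (d + 1) w (fun y => mainG h t (d + 1) u c₀ c₁ y * tupleWeight x y) =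
        sliceIntegral (d + 1) w (fun y => x ^ w * Ψ (ρ⁻¹ • y)) := by
      refine sliceIntegral_congr fun y hy hsum => ?_
      have hc' : c₀ < ∑ j, y j ∧ ∑ j, y j ≤ c₁ := by rw [hsum]; exact hc
      unfold mainG
      rw [if_pos hc', normVec_eq_append u y hsum, ← hρdef, ← hξ]
      show h (t + (d + 1)) (Fin.append ξ (ρ⁻¹ • y)) * tupleWeight x y =
        x ^ w * (h (t + (d + 1)) (Fin.append ξ (ρ⁻¹ • y)) / (ρ ^ (d + 1) * ∏ i, (ρ⁻¹ • y) i))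
      unfold tupleWeight
      rw [Finset.prod_div_distrib, ← Real.rpow_sum_of_pos hx, hsum]
      have hprod : ∏ i, (ρ⁻¹ • y) i = (ρ ^ (d + 1))⁻¹ * ∏ i, y i := by
        simp only [Pi.smul_apply, smul_eq_mul]
        rw [Finset.prod_mul_distrib, Finset.prod_const, Finset.card_univ, Fintype.card_fin, inv_pow]
      rw [hprod]
      have hρ0 : ρ ≠ 0 := hρ.ne'
      have hP0 : ∏ i, y i ≠ 0 := Finset.prod_ne_zero_iff.2 fun i _ => (hy i).ne'
      field_simp
    rw [hcongr, sliceIntegral_const_mul, sliceIntegral_comp_smul d w hρ Ψ]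
    -- identify with `typeITerm`
    have hwρ : w / ρ = 1 - ∑ i, ξ i := by
      have hsξ : ∑ i, ξ i = (∑ i, u i) / ρ := by rw [hξ, Finset.sum_div]
      rw [hsξ, eq_sub_iff_add_eq, ← add_div, div_eq_one_iff_eq hρ.ne', hρdef]
      ring
    have hslice : sliceIntegral (d + 1) (w / ρ) Ψ =
        (ρ ^ (d + 1))⁻¹ * sliceIntegral (d + 1) (1 - ∑ i, ξ i)
          (fun z => h (t + (d + 1)) (Fin.append ξ z) / ∏ i, z i) := by
      rw [hwρ, ← sliceIntegral_const_mul]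
      refine sliceIntegral_congr fun z _ _ => ?_
      rw [hΨ]; simp only []
      rw [mul_comm (ρ ^ (d + 1)), ← div_div, div_eq_mul_inv _ (ρ ^ (d + 1)), mul_comm]
    rw [hslice]
    unfold typeITerm
    have hfact : ((d + 1).factorial : ℝ) ≠ 0 := by positivity
    have hρ0 : ρ ≠ 0 := hρ.ne'
    field_simp
    ring
  · -- off the range: the integrand vanishes on the slice
    rw [← sliceIntegral_zero (d + 1) w]
    refine sliceIntegral_congr fun y _ hsum => ?_
    unfold mainG
    rw [if_neg (by rw [hsum]; exact hc), zero_mul]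

/-- **The main term vanishes by (TypeI-f).** Let `h` be bounded, measurable, supported on vectors
with components `≥ η > 0`, vanishing in dimensions `> K_max`, and satisfying (TypeI-f) with
parameter `γ`. Fix `x > 1`, `u ∈ ℝ^t` (`λ = |u|`) and a range `(c₀, c₁]`, `c₁ ≤ 1`, `λ + c₀ > 0`,
such that `λ ≤ γ (λ + w)` for all `w ∈ (c₀, c₁]`. Then
`∑_{s=1}^{S} (1/s!) ∫_{ℝ^s} h((u,y)/(λ+|y|)) 𝟙(c₀ < |y| ≤ c₁) ∏ x^{yᵢ} dyᵢ/yᵢ = 0`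
for every `S ≥ K_max − t`: slice by `|y| = w`, rescale by `λ + w`, and apply (TypeI-f) at
`ξ = u/(λ + w)`, `|ξ| ≤ γ`. This is the computation concluding the proof of (construction-TypeI)
in §6.2. [cite: FordMaynard2024PrimeSieves, §6.2 (proof of Theorem 6.3 (a))] -/
theorem sum_primeTupleIntegral_mainG_eq_zero {h : VecFn} {γ η Hb : ℝ} (hη : 0 < η)
    (hsupp : ∀ (k : ℕ) (v : Fin k → ℝ), h k v ≠ 0 → ∀ i, η ≤ v i)
    (hbdd : ∀ (k : ℕ) (v : Fin k → ℝ), |h k v| ≤ Hb) (hmeas : ∀ k, Measurable (h k))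
    (htypeI : TypeIIdentity γ h) {Kmax : ℕ} (hvan : ∀ k, Kmax < k → ∀ v, h k v = 0)
    {x : ℝ} (hx : 1 < x) {t : ℕ} (u : Fin t → ℝ) {c₀ c₁ : ℝ} (hc₁ : c₁ ≤ 1)
    (hlc₀ : 0 < (∑ i, u i) + c₀)
    (hγw : ∀ w, c₀ < w → w ≤ c₁ → (∑ i, u i) ≤ γ * ((∑ i, u i) + w)) {S : ℕ} (hS : Kmax ≤ t + S) :
    ∑ s ∈ Finset.Icc 1 S, (1 / (s.factorial : ℝ)) * primeTupleIntegral s x (mainG h t s u c₀ c₁) = 0 := by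
  have hx0 : 0 < x := by linarith
  -- each term is an integral over `w` of slice integrals
  have hterm : ∀ s ∈ Finset.Icc 1 S,
      (1 / (s.factorial : ℝ)) * primeTupleIntegral s x (mainG h t s u c₀ c₁) =
        ∫ w, (1 / (s.factorial : ℝ)) *
          sliceIntegral s w (fun y => mainG h t s u c₀ c₁ y * tupleWeight x y) ∧
      Integrable (fun w => (1 / (s.factorial : ℝ)) *
          sliceIntegral s w (fun y => mainG h t s u c₀ c₁ y * tupleWeight x y)) := by
    intro s hs
    rw [Finset.mem_Icc] at hs
    obtain ⟨d, rfl⟩ : ∃ d, s = d + 1 := ⟨s - 1, by omega⟩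
    obtain ⟨hint, hpos⟩ := integrable_mainG_mul_tupleWeight hη hsupp hbdd hmeas hx u hc₁ hlc₀ (d + 1)
    obtain ⟨heq, hint'⟩ := integral_eq_integral_sliceIntegral hint hpos
    refine ⟨?_, hint'.const_mul _⟩
    unfold primeTupleIntegral
    rw [heq, integral_const_mul]
  rw [Finset.sum_congr rfl fun s hs => (hterm s hs).1,
    ← integral_finsetSum _ fun s hs => (hterm s hs).2]
  refine integral_eq_zero_of_ae (Filter.Eventually.of_forall fun w => ?_)
  show ∑ s ∈ Finset.Icc 1 S, (1 / (s.factorial : ℝ)) *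
      sliceIntegral s w (fun y => mainG h t s u c₀ c₁ y * tupleWeight x y) = 0
  by_cases hc : c₀ < w ∧ w ≤ c₁
  · have hρ : 0 < (∑ i, u i) + w := by linarith [hc.1]
    set ρ : ℝ := (∑ i, u i) + w with hρdef
    set ξ : Fin t → ℝ := fun i => u i / ρ with hξ
    -- every term is `x^w/ρ · typeITerm h t ξ s`
    have hrw : ∀ s ∈ Finset.Icc 1 S, (1 / (s.factorial : ℝ)) *
        sliceIntegral s w (fun y => mainG h t s u c₀ c₁ y * tupleWeight x y) =
          x ^ w / ρ * typeITerm h t ξ s := by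
      intro s hs
      rw [Finset.mem_Icc] at hs
      obtain ⟨d, rfl⟩ : ∃ d, s = d + 1 := ⟨s - 1, by omega⟩
      rw [sliceIntegral_mainG h hx0 u c₀ c₁ d w hρ, if_pos hc, ← hρdef, ← hξ]
      have hfact : ((d + 1).factorial : ℝ) ≠ 0 := by positivity
      field_simp
    rw [Finset.sum_congr rfl hrw, ← Finset.mul_sum]
    -- (TypeI-f) at `ξ`
    have hξγ : ∑ i, ξ i ≤ γ := by
      have hsξ : ∑ i, ξ i = (∑ i, u i) / ρ := by rw [hξ, Finset.sum_div]
      rw [hsξ, div_le_iff₀ hρ]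
      exact hγw w hc.1 hc.2
    obtain ⟨N₀, hN₀⟩ := htypeI t ξ hξγ
    have hbig := hN₀ (max N₀ S) (le_max_left _ _)
    -- the terms beyond `S` vanish
    have hsplit : ∑ s ∈ Finset.Icc 1 (max N₀ S), typeITerm h t ξ s =
        ∑ s ∈ Finset.Icc 1 S, typeITerm h t ξ s := by
      refine (Finset.sum_subset (Finset.Icc_subset_Icc_right (le_max_right _ _)) ?_).symm
      intro s hs hs'
      rw [Finset.mem_Icc] at hs hs'
      have hsS : S < s := by omega
      unfold typeITerm
      rw [sliceIntegral_congr (G' := fun _ => 0) fun v _ _ => by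
        rw [hvan (t + s) (by omega) _, zero_div], sliceIntegral_zero, mul_zero]
    rw [hsplit] at hbig
    rw [hbig, mul_zero]
  · refine Finset.sum_eq_zero fun s hs => ?_
    rw [Finset.mem_Icc] at hs
    obtain ⟨d, rfl⟩ : ∃ d, s = d + 1 := ⟨s - 1, by omega⟩
    by_cases hρ : 0 < (∑ i, u i) + w
    · rw [sliceIntegral_mainG h hx0 u c₀ c₁ d w hρ, if_neg hc, mul_zero]
    · -- `w ≤ -λ < c₀`: the range condition fails on the slice as well
      rw [sliceIntegral_congr (G' := fun _ => 0) fun y _ hsum => by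
        unfold mainG
        rw [if_neg (by rw [hsum]; exact hc), zero_mul], sliceIntegral_zero, mul_zero]

end Literature.NumberTheory.Sieve.FordMaynard
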